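/-
Copyright (c) 2026. Released under Apache 2.0 license.
Literature formalization: the Baker–Davenport reduction in the form of Dujella–Pethő.
-/
import Mathlib

/-!
# The Baker–Davenport reduction lemma (Dujella–Pethő form)

[cite: DujellaPetho1998, Lemma 5 (a)]

A. Dujella and A. Pethő, *A generalization of a theorem of Baker and Davenport*, Quart. J. Math.
Oxford Ser. (2) **49** (1998), 291–306, Lemma 5 (a) (going back to A. Baker, H. Davenport,
Quart. J. Math. Oxford (2) 20 (1969), 129–137): let `M` be a positive integer, `p/q` a convergent
of the continued fraction of the irrational `κ` with `q > 6M`, and put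
`ε = ‖μ q‖ - M ‖κ q‖`, where `‖·‖` is the distance to the nearest integer.  If `ε > 0`, then
there is no solution of `0 < m κ - n + μ < A B^{-m}` in integers `m, n` with
`log(Aq/ε)/log B ≤ m ≤ M`.

We prove the statement in the form in which it is used in computations: for ANY integers
`p, q` with `q ≥ 1` (in practice `p/q` is a convergent of `κ`, which makes `|κq - p|` small) and
`ε := |μq - round(μq)| - M |κq - p| > 0`, every solution `(m, n)` with `0 ≤ m ≤ M` of
`0 < mκ - n + μ < A B^{-m}` has `m < log(Aq/ε)/log B` (`bakerDavenport_reduction`).  The only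
property of convergents used in the printed proof is `‖κq‖ = |κq - p|`; with `|κq - p|` in place
of `‖κq‖` the hypothesis `ε > 0` is stronger, so nothing is lost.  This is the reduction step of
[LettlPetho1995] and of most explicit resolutions of Thue and index form equations.
-/

namespace Literature.NumberTheory.DiophantineApproximation

/-- The nearest integer minimises the distance to `ℤ`: `|x - round x| ≤ |x - N|` for every
integer `N` [folklore]. -/
theorem abs_sub_round_le_abs_sub_int (x : ℝ) (N : ℤ) : |x - round x| ≤ |x - N| := by
  by_contra h
  push Not at h
  have h1 : |x - round x| ≤ 1 / 2 := abs_sub_round x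
  have hne : (N : ℝ) ≠ round x := by
    intro e
    rw [← e] at h
    exact lt_irrefl _ h
  have hne' : N ≠ round x := fun e => hne (by rw [e])
  have hdist : (1 : ℝ) ≤ |(N : ℝ) - round x| := by
    rw [show (N : ℝ) - round x = ((N - round x : ℤ) : ℝ) by push_cast; ring]
    exact_mod_cast Int.one_le_abs (sub_ne_zero.mpr hne')
  have htri : |(N : ℝ) - round x| ≤ |x - N| + |x - round x| := by
    rw [show (N : ℝ) - round x = (x - round x) - (x - N) by ring]
    exact (abs_sub _ _).trans (by rw [add_comm])
  linarith

/-- **Baker–Davenport reduction (Dujella–Pethő, Lemma 5 (a))** [cite: DujellaPetho1998,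
Lemma 5 (a)]: let `κ, μ, A` be real (`A > 0` in the source; not needed), `B > 1`, `M` a natural number, `p, q` integers with
`q ≥ 1`, and suppose `ε := |μq - round(μq)| - M |κq - p| > 0`.  If integers `m, n` with
`0 ≤ m ≤ M` satisfy `0 < mκ - n + μ < A B^{-m}`, then `m < log(Aq/ε)/log B`.  (For a convergent
`p/q` of `κ`, `|κq - p| = ‖κq‖` and this is the printed statement: no solutions with
`log(Aq/ε)/log B ≤ m ≤ M`.) -/
theorem bakerDavenport_reduction {κ μ A B : ℝ} {M : ℕ} {p q : ℤ} (hB : 1 < B)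
    (hq : 1 ≤ q) (hε : 0 < |μ * q - round (μ * q)| - M * |κ * q - p|) {m n : ℤ} (hm0 : 0 ≤ m)
    (hmM : m ≤ M) (hlow : 0 < m * κ - n + μ) (hupp : m * κ - n + μ < A * B ^ (-(m : ℝ))) :
    (m : ℝ) < Real.log (A * q / (|μ * q - round (μ * q)| - M * |κ * q - p|)) / Real.log B := by
  set ε : ℝ := |μ * q - round (μ * q)| - M * |κ * q - p| with hε_def
  have hqR : (1 : ℝ) ≤ q := by exact_mod_cast hq
  have hq0 : (0 : ℝ) < q := by linarith
  have hBm : 0 < B ^ (-(m : ℝ)) := Real.rpow_pos_of_pos (by linarith) _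
  -- multiply the inequality by `q` and isolate `μ q - (n q - m p)`
  have hkey : |μ * q - round (μ * q)| < q * A * B ^ (-(m : ℝ)) + M * |κ * q - p| := by
    have h1 : |μ * q - round (μ * q)| ≤ |μ * q - ((n * q - m * p : ℤ) : ℝ)| :=
      abs_sub_round_le_abs_sub_int _ _
    have h2 : μ * q - ((n * q - m * p : ℤ) : ℝ) = (m * κ - n + μ) * q - m * (κ * q - p) := by
      push_cast; ring
    have h3 : |(m * κ - n + μ) * q| < q * A * B ^ (-(m : ℝ)) := by
      rw [abs_of_pos (by positivity)]
      nlinarith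
    have h4 : |(m : ℝ) * (κ * q - p)| ≤ M * |κ * q - p| := by
      rw [abs_mul, abs_of_nonneg (by exact_mod_cast hm0)]
      exact mul_le_mul_of_nonneg_right (by exact_mod_cast hmM) (abs_nonneg _)
    calc |μ * q - round (μ * q)| ≤ |μ * q - ((n * q - m * p : ℤ) : ℝ)| := h1
      _ = |(m * κ - n + μ) * q - m * (κ * q - p)| := by rw [h2]
      _ ≤ |(m * κ - n + μ) * q| + |(m : ℝ) * (κ * q - p)| := abs_sub _ _
      _ < q * A * B ^ (-(m : ℝ)) + M * |κ * q - p| := by linarith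
  -- hence `ε < q A B^{-m}`, i.e. `B^m < A q / ε`
  have hε' : ε < q * A * B ^ (-(m : ℝ)) := by rw [hε_def]; linarith
  have hBpos : (0 : ℝ) < B := by linarith
  have hpow : B ^ (m : ℝ) < A * q / ε := by
    rw [lt_div_iff₀ hε, ← lt_div_iff₀' (Real.rpow_pos_of_pos hBpos _)] at *
    calc ε < q * A * B ^ (-(m : ℝ)) := hε'
      _ = A * q / B ^ (m : ℝ) := by rw [Real.rpow_neg hBpos.le]; ring
  -- take logarithms
  have hlogB : 0 < Real.log B := Real.log_pos hB
  rw [lt_div_iff₀ hlogB, ← Real.log_rpow hBpos]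
  exact Real.log_lt_log (Real.rpow_pos_of_pos hBpos _) hpow

end Literature.NumberTheory.DiophantineApproximation
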